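import Mathlib
import Literature.NumberTheory.LFunctions.Zhang2022.Section11AFEObjects
import Literature.NumberTheory.LFunctions.Zhang2022.Section5Lemma51
import HarnessLib

/-!
# Zhang (2022) §11, proof of Lemma 11.2 for `χψ` — kernel blocks (a), (e), (B2) of `Z22:§11.u024`

Topic `Literature/NumberTheory/LFunctions/Zhang2022` (Landau–Siegel audit tree; verdict-neutral).
Y. Zhang, *Discrete mean estimates and the Landau–Siegel zero*, arXiv:2211.02515v1 (2022)
[Zhang2022LandauSiegel] — **an unrefereed manuscript under adjudication** (campaign D-0069; nothing
here bears on Theorems 1–2 or on Landau–Siegel zeros). Companion of `Section11AFEObjects` (objects,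
the repaired node `Step11u024e`, the typed sub-steps). PROVED here, for the smoothed approximate
functional equation of `L(s,χψ)` (Z22 p. 65, tex L3329–3331, "in a way similar to the proof of
Lemma 6.1"):

* `vline_one_eq_smoothedSum` — **(a)**: `(1/2πi)∫_{(1)} L(s+w,χψ)X^wω₁(w)dw/w = Σ_nχψ(n)n^{−s}g(X/n)`
  (the first display of the proof of Lemma 6.1, tex L1707, for `χψ`; the tree's
  `GaussWeight.integral_LSeries_mul_kernel`);
* `vline_integrandMain` — **(e)** = (6.4)/`I′`: `(1/2πi)∫_{(−1)} Z(s,χψ)R^{−w}(Σ_{n<N}χψ̄(n)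
  n^{−(1−s−w)})X^wω₁(w)dw/w = −Z(s,χψ)Σ_{n<N}χψ̄(n)n^{−(1−s)}g(R/(Xn))` EXACTLY ("using the change
  of variable `w → −w`", tex L1774; finite Perron on the right line);
* `norm_vseg_integrandDiff_le` — **(B2)**: on the window `u = 0`, `|v| ≤ 𝓛²⁰`, the `I″`-integral is
  `≤ C·E₂(s,ψ)` — THIS is where Lemma 5.1 (5.4) enters Lemma 11.2: the tree's theorem
  `Skeleton.lemma51_holds` (tex L1778: "moving the segment … to `u = 0`, `|v| ≤ 𝓛²⁰` and applying
  Lemma 5.1, we find the right side of (6.5) is `≪ E₁(s,ψ)`").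

## References

* Y. Zhang, arXiv:2211.02515v1 (2022), §6 proof of Lemma 6.1, pp. 31–32; §11 Lemma 11.2, p. 65;
  §5 Lemma 5.1 (5.4). [cite: Zhang2022LandauSiegel, §6 Lemma 6.1 (proof); §11 Lemma 11.2]
-/

noncomputable section

open Complex Real ComplexConjugate MeasureTheory Set Filter Topology

namespace Literature.NumberTheory.LFunctions.Zhang2022.Section11AFE

open Skeleton GaussWeight Section6Statements

/-! ## §2. Block (a): the line `u = 1` is the smoothed sum (the §6 line `∫_{(1)}`) -/

section BlockA

variable {D : ℕ} [NeZero D] (χ : DirichletCharacter ℂ D) (x : Chr D)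

/-- **(a)** For `Re s > 0`, `X > 0` and `D ≥ 2` (so `𝓛³⁰ > 0`):
`(1/2πi)∫_{(1)} L(s+w,χψ)X^wω₁(w)dw/w = Σ_n χψ(n)n^{−s}g(X/n)` — the tree's
`GaussWeight.integral_LSeries_mul_kernel` with the absolutely convergent series at `s + 1`.
[cite: Zhang2022LandauSiegel, §6 p. 31 (first display of the proof of Lemma 6.1); §11 p. 65] -/
theorem vline_one_eq_smoothedSum (hD : 2 ≤ D) {s : ℂ} (hs : 0 < s.re) (hs0 : s ≠ 0) {X : ℝ}
    (hX : 0 < X) : vline (integrandL χ x X s) 1 = smoothedSum χ x X s := by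
  have hΛ : 0 < ell D ^ 30 := pow_pos (by
    have : (1 : ℝ) < D := by exact_mod_cast hD
    exact Real.log_pos this) _
  have hsum : LSeriesSummable (fun n => pc χ x n) (s + (1 : ℝ)) := by
    refine LSeriesSummable_of_bounded_of_one_lt_re (m := 1) (fun n _ => by
      rw [pc, norm_mul]; exact mul_le_one₀ (x.ψ.norm_le_one _) (norm_nonneg _) (χ.norm_le_one _)) ?_
    simp only [add_re, ofReal_re]; linarith
  have key := integral_LSeries_mul_kernel hΛ one_pos hX hsum
  -- the integrand of `vline … 1` is the one of `key`
  have hint : (fun v : ℝ => integrandL χ x X s (((1 : ℝ) : ℂ) + (v : ℂ) * I)) =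
      fun t : ℝ => LSeries (fun n => pc χ x n) (s + ((1 : ℝ) + t * I)) * kernel (ell D ^ 30) 1 X t := by
    funext t
    have hre : 1 < (s + ((1 : ℝ) + t * I)).re := by simp; linarith
    rw [integrandL, LFunction_psiChi_eq_LSeries χ x hre, kern, kernel]
  rw [vline, hint, key, smoothedSum]
  refine tsum_congr fun n => ?_
  rcases Nat.eq_zero_or_pos n with rfl | hn
  · simp [LSeries.term_zero, Complex.zero_cpow (neg_ne_zero.mpr hs0)]
  · rw [LSeries.term_of_ne_zero hn.ne', div_eq_mul_inv, ← Complex.cpow_neg, gW]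

end BlockA

/-! ## §3. Block (e): the main term `I′` on the line `u = −1`, exactly -/

section BlockE

variable {D : ℕ} [NeZero D] (χ : DirichletCharacter ℂ D) (x : Chr D)

/-- **(e) = the (6.4)/`I′` step, exact**: on the line `u = −1`,
`(1/2πi)∫_{(−1)} Z(s,χψ)R^{−w}(Σ_{n<N}\overline{χψ}(n)n^{−(1−s−w)})X^wω₁(w)dw/w
= −Z(s,χψ)·Σ_{n<N}\overline{χψ}(n)n^{−(1−s)}g(R/(Xn))` ("Replacing the segment … by `u = −1` and
using the change of variable `w → −w`, we obtain `I′ = −Z(s,ψ)N(1−s,ψ̄) + O(ε)`" — here with the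
smooth `g` in place of `g*`, there is no `O(ε)`). Finite Perron on the right line (the tree's
`GaussWeight.integral_sum_mul_kernel`) after `w → −w`. [cite: Zhang2022LandauSiegel, §6 (6.4) p.32; §11 p.65] -/
theorem vline_integrandMain (hD : 2 ≤ D) {X : ℝ} (hX : 0 < X) (hR : 0 < bigR D) (N : ℝ) (s : ℂ) :
    vline (integrandMain χ x X N s) (-1) = -(Zpc χ x s * dualHead χ x (bigR D / X) N s) := by
  have hΛ : 0 < ell D ^ 30 := pow_pos (by
    have : (1 : ℝ) < D := by exact_mod_cast hD
    exact Real.log_pos this) _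
  have hY : 0 < bigR D / X := div_pos hR hX
  set b : ℕ → ℂ := fun n => conj (pc χ x n) with hb
  set e : ℂ := 1 - s with he
  set G : ℝ → ℂ := fun u =>
    (∑ n ∈ Finset.Ico 1 ⌈N⌉₊, LSeries.term b (e + (((1 : ℝ) : ℂ) + (u : ℂ) * I)) n) *
      kernel (ell D ^ 30) 1 (bigR D / X) u with hG
  -- the integrand at `w = -1 + iv` is `-Z(s)·G(-v)`
  have hpt : ∀ v : ℝ, integrandMain χ x X N s (((-1 : ℝ) : ℂ) + (v : ℂ) * I) =
      -(Zpc χ x s * G (-v)) := by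
    intro v
    have hw : (((-1 : ℝ) : ℂ) + (v : ℂ) * I) = -(((1 : ℝ) : ℂ) + ((-v : ℝ) : ℂ) * I) := by
      push_cast; ring
    have hhead : headPc χ x N s (((-1 : ℝ) : ℂ) + (v : ℂ) * I) =
        ∑ n ∈ Finset.Ico 1 ⌈N⌉₊, LSeries.term b (e + (((1 : ℝ) : ℂ) + ((-v : ℝ) : ℂ) * I)) n := by
      rw [headPc]
      refine Finset.sum_congr rfl fun n hn => ?_
      have hn0 : n ≠ 0 := by
        have := (Finset.mem_Ico.mp hn).1; omega
      rw [LSeries.term_of_ne_zero hn0, hb, he, div_eq_mul_inv, ← Complex.cpow_neg, hw]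
      congr 2
      ring
    have hkern : ((bigR D : ℝ) : ℂ) ^ (-(((-1 : ℝ) : ℂ) + (v : ℂ) * I)) *
        kern D X (((-1 : ℝ) : ℂ) + (v : ℂ) * I) = -kernel (ell D ^ 30) 1 (bigR D / X) (-v) := by
      rw [kern_neg_line hX 1 v, hw, neg_neg, kernel, kernel, div_eq_mul_inv (bigR D) X]
      rw [← cpow_ofReal_mul_cpow_ofReal hR (inv_pos.mpr hX)]
      ring
    rw [integrandMain, hhead]
    calc Zpc χ x s * ((bigR D : ℝ) : ℂ) ^ (-(((-1 : ℝ) : ℂ) + (v : ℂ) * I)) *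
          (∑ n ∈ Finset.Ico 1 ⌈N⌉₊, LSeries.term b (e + (((1 : ℝ) : ℂ) + ((-v : ℝ) : ℂ) * I)) n) *
          kern D X (((-1 : ℝ) : ℂ) + (v : ℂ) * I)
        = Zpc χ x s *
          (∑ n ∈ Finset.Ico 1 ⌈N⌉₊, LSeries.term b (e + (((1 : ℝ) : ℂ) + ((-v : ℝ) : ℂ) * I)) n) *
          (((bigR D : ℝ) : ℂ) ^ (-(((-1 : ℝ) : ℂ) + (v : ℂ) * I)) *
            kern D X (((-1 : ℝ) : ℂ) + (v : ℂ) * I)) := by ring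
      _ = -(Zpc χ x s * G (-v)) := by rw [hkern, hG]; ring
  -- integrate
  have hint : ∫ v : ℝ, integrandMain χ x X N s (((-1 : ℝ) : ℂ) + (v : ℂ) * I) =
      -(Zpc χ x s * ∫ v : ℝ, G v) := by
    simp_rw [hpt]
    rw [integral_neg, integral_const_mul, integral_neg_eq_self G volume]
  have key := integral_sum_mul_kernel hΛ one_pos hY (Finset.Ico 1 ⌈N⌉₊) b e
  rw [vline, hint, dualHead]
  have hterm : ∀ n ∈ Finset.Ico 1 ⌈N⌉₊, LSeries.term b e n * (gWeight (ell D ^ 30) (bigR D / X / n) : ℂ)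
      = conj (pc χ x n) * (n : ℂ) ^ (-(1 - s)) * (gW D (bigR D / X / n) : ℂ) := by
    intro n hn
    have hn0 : n ≠ 0 := by
      have := (Finset.mem_Ico.mp hn).1; omega
    rw [LSeries.term_of_ne_zero hn0, hb, he, div_eq_mul_inv, ← Complex.cpow_neg, gW]
  rw [← Finset.sum_congr rfl hterm, ← key, hG]
  ring

end BlockE

/-! ## §4. Block (B2): the window `u = 0`, `|v| ≤ 𝓛²⁰` is `O(E₂(s,ψ))` by Lemma 5.1 (5.4) -/

section BlockB2

variable {D : ℕ} [NeZero D] (χ : DirichletCharacter ℂ D) (x : Chr D)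

/-- **(B2) = the last sentence of the proof of Lemma 6.1, for `χψ`**: on the window `u = 0`,
`|v| ≤ 𝓛²⁰`, by Lemma 5.1 (5.4) (`Skeleton.lemma51_holds`, the tree's theorem) the `I″`-integrand
`(Z(s+iv,χψ) − Z(s,χψ)(DPt₀)^{−iv})/(iv) · Σ_{n<P₁}\overline{χψ}(n)n^{−(1−s−iv)} · X^{iv}ω₁(iv)` is
bounded by `C𝓛⁻⁶⁸|Σ_{n<P₁}χψ(n)n^{−(s+iv)}|ω₁(iv)`, so that
`|(1/2π)∫_{−𝓛²⁰}^{𝓛²⁰} …| ≤ C·E₂(s,ψ)` — for every `ψ ∈ Ψ`, `σ = 1/2`, `|t − 2πt₀| < 𝓛₁`, `X > 0`,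
`D` large ("moving the segment … to `u = 0`, `|v| ≤ 𝓛²⁰` and applying Lemma 5.1, we find the right
side of (6.5) is `≪ E₁(s,ψ)`"). [cite: Zhang2022LandauSiegel, §6 p. 32; §11 Lemma 11.2 p. 65] -/
theorem norm_vseg_integrandDiff_le :
    ∃ C : ℝ, ForAllLarge fun D _ χ => ∀ x : Chr D, ∀ s : ℂ, InRange112 D s → ∀ X : ℝ, 0 < X →
      ‖vseg (integrandDiff χ x X (Skeleton.P1 D) s) 0 (ell D ^ 20)‖ ≤ C * E2main χ x s := by
  obtain ⟨C₅₁, D₀, h51⟩ := lemma51_holds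
  refine ⟨|C₅₁|, max D₀ 3, fun D _ χ hD hq hp x s hs X hX => ?_⟩
  have hD₀ : D₀ ≤ D := le_trans (le_max_left _ _) hD
  have hD3 : 3 ≤ D := le_trans (le_max_right _ _) hD
  obtain ⟨hre, him⟩ := hs
  have hℓ : 0 ≤ ell D := Real.log_natCast_nonneg D
  have hα : 0 ≤ alpha D := by
    rw [alpha, bigP, Real.log_exp]; positivity
  have hrange : InRange51 D s := by
    refine ⟨?_, by linarith⟩
    rw [hre]; simpa using hα
  set V : ℝ := ell D ^ 20 with hV
  have hV0 : 0 ≤ V := pow_nonneg hℓ 20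
  set F : ℝ → ℂ := fun v => integrandDiff χ x X (Skeleton.P1 D) s (((0 : ℝ) : ℂ) + (v : ℂ) * I) with hF
  set g : ℝ → ℝ := fun v => |C₅₁| * (ell D ^ 68)⁻¹ *
    (‖∑ n ∈ Finset.Ico 1 ⌈Skeleton.P1 D⌉₊, pc χ x n * (n : ℂ) ^ (-(s + v * I))‖ *
      Real.exp (-(v ^ 2) / (4 * ell D ^ 30))) with hg
  -- pointwise bound off `v = 0`, `|v| < V`
  have hpt : ∀ v : ℝ, v ≠ 0 → |v| < V → ‖F v‖ ≤ g v := by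
    intro v hv0 hvV
    have h4 := (h51 D χ hD₀ hq hp x s hrange v hv0 hvV).2.2.2
    have hvI : ((0 : ℝ) : ℂ) + (v : ℂ) * I = v * I := by simp
    set A : ℂ := (Zpc χ x (s + v * I) - Zpc χ x s *
        (((D : ℝ) * bigP D * t0 D : ℝ) : ℂ) ^ (-(v * I))) / (v * I) with hA
    set H : ℂ := headPc χ x (Skeleton.P1 D) s (v * I) with hH
    set S : ℂ := ∑ n ∈ Finset.Ico 1 ⌈Skeleton.P1 D⌉₊, pc χ x n * (n : ℂ) ^ (-(s + v * I)) with hS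
    have hsplit : F v = A * H * (((X : ℝ) : ℂ) ^ ((v : ℂ) * I) * omega1 (ell D ^ 30) (v * I)) := by
      simp only [hF, integrandDiff, kern, hvI, bigR, hA, hH]
      ring
    have hX1 : ‖((X : ℝ) : ℂ) ^ ((v : ℂ) * I)‖ = 1 := by
      rw [Complex.norm_cpow_eq_rpow_re_of_pos hX]; simp
    have hHS : ‖H‖ = ‖S‖ := by rw [hH, hS]; exact norm_headPc_I χ x hre _ v
    have hC : C₅₁ * (ell D ^ 68)⁻¹ ≤ |C₅₁| * (ell D ^ 68)⁻¹ :=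
      mul_le_mul_of_nonneg_right (le_abs_self _) (inv_nonneg.mpr (pow_nonneg hℓ _))
    have hAle : ‖A‖ ≤ |C₅₁| * (ell D ^ 68)⁻¹ := h4.trans hC
    rw [hsplit]
    calc ‖A * H * (((X : ℝ) : ℂ) ^ ((v : ℂ) * I) * omega1 (ell D ^ 30) (v * I))‖
        = ‖A‖ * ‖H‖ * (‖((X : ℝ) : ℂ) ^ ((v : ℂ) * I)‖ * ‖omega1 (ell D ^ 30) (v * I)‖) := by
          simp only [norm_mul]
      _ = ‖A‖ * ‖S‖ * Real.exp (-(v ^ 2) / (4 * ell D ^ 30)) := by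
          rw [hX1, hHS, norm_omega1_I, one_mul]
      _ ≤ |C₅₁| * (ell D ^ 68)⁻¹ * ‖S‖ * Real.exp (-(v ^ 2) / (4 * ell D ^ 30)) :=
          mul_le_mul_of_nonneg_right (mul_le_mul_of_nonneg_right hAle (norm_nonneg _))
            (Real.exp_nonneg _)
      _ = g v := by simp only [hg, hS]; ring
  -- `g` is continuous, hence interval integrable
  have hgc : Continuous g := by
    have hsum : Continuous fun v : ℝ =>
        ∑ n ∈ Finset.Ico 1 ⌈Skeleton.P1 D⌉₊, pc χ x n * (n : ℂ) ^ (-(s + v * I)) := by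
      refine continuous_finsetSum _ fun n hn => ?_
      have hn0 : (n : ℂ) ≠ 0 := by
        have := (Finset.mem_Ico.mp hn).1; exact_mod_cast (by omega : n ≠ 0)
      exact continuous_const.mul (Continuous.const_cpow (by fun_prop) (Or.inl hn0))
    rw [hg]
    fun_prop
  have hgi : IntervalIntegrable g volume (-V) V := hgc.intervalIntegrable _ _
  -- the a.e. form of the pointwise bound on `(-V, V]`
  have hae : ∀ᵐ v : ℝ ∂volume, v ∈ Set.Ioc (-V) V → ‖F v‖ ≤ g v := by
    have h0 : ∀ᵐ v : ℝ ∂volume, v ≠ 0 := by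
      have : ({0}ᶜ : Set ℝ) ∈ ae volume := compl_mem_ae_iff.mpr (measure_singleton _)
      filter_upwards [this] with v hv using hv
    have h1 : ∀ᵐ v : ℝ ∂volume, v ≠ V := by
      have : ({V}ᶜ : Set ℝ) ∈ ae volume := compl_mem_ae_iff.mpr (measure_singleton _)
      filter_upwards [this] with v hv using hv
    filter_upwards [h0, h1] with v hv0 hv1 hv
    rw [Set.mem_Ioc] at hv
    exact hpt v hv0 (abs_lt.mpr ⟨hv.1, lt_of_le_of_ne hv.2 hv1⟩)
  have hint := intervalIntegral.norm_integral_le_of_norm_le (by linarith : -V ≤ V) hae hgi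
  -- `∫ g = |C₅₁|·E₂`
  have hgint : ∫ v in (-V)..V, g v = |C₅₁| * E2main χ x s := by
    rw [hg, E2main, intervalIntegral.integral_const_mul, hV, mul_assoc]
  rw [hgint] at hint
  -- `‖(1/2π)∫F‖ ≤ ‖∫F‖`
  rw [vseg]
  have h2π : ‖(1 / (2 * π) : ℂ)‖ ≤ 1 := by
    have : (1 / (2 * π) : ℂ) = ((1 / (2 * π) : ℝ) : ℂ) := by push_cast; ring
    rw [this, Complex.norm_real, Real.norm_eq_abs, abs_of_pos (by positivity)]
    rw [div_le_one (by positivity)]; linarith [Real.pi_gt_three]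
  calc ‖(1 / (2 * π) : ℂ) * ∫ v in (-V)..V, F v‖
      = ‖(1 / (2 * π) : ℂ)‖ * ‖∫ v in (-V)..V, F v‖ := norm_mul _ _
    _ ≤ 1 * (|C₅₁| * E2main χ x s) := by gcongr
    _ = |C₅₁| * E2main χ x s := one_mul _

end BlockB2

end Literature.NumberTheory.LFunctions.Zhang2022.Section11AFE
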